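import Summits.AtomisticToContinuum.BoseEinsteinCondensation.Theorems.BECGroundStateSOSPeriodicIRBoundTwoSectorLowDefs
import Summits.AtomisticToContinuum.BoseEinsteinCondensation.Theorems.BECGroundStateSOSPeriodicIRBoundReductionIntegrable
import Summits.AtomisticToContinuum.BoseEinsteinCondensation.Theorems.BECGroundStateSOSPeriodicIRBoundTwoSectorWindowT
import HarnessLib

/-!
# Route `BECGroundStateSOS`, crux `PeriodicIRBound` (stmt-AtomisticToContinuum-3972), line `two-sector-gd-transfer`
# (v9 "momentum-zero test vectors, relaxed guard, low window") — stub S9b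
# `stub_linearFloorGivesFloatingLowOf : LinearFloorGivesFloatingLowOf`

Supports (does not close) stmt-AtomisticToContinuum-3972. The registered stub S9b of the v9 skeleton
`Cruxes/PeriodicIRBound/Lines/two_sector_gd_transfer.lean` (statement `LinearFloorGivesFloatingLowOf` in
`Theorems/BECGroundStateSOSPeriodicIRBoundTwoSectorLowDefs.lean`): the assembly of the arrow "line 1's linear
particle–hole floor `C⁺` gives the low-window floating two-channel bound `FloatingForLow`" from its two analytic inputs,
taken as hypotheses — S9c `LatticeSectorEnergyFinite` (`E_M(2πn/L) < ⊤` for integrable `v`) and S9a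
`ChannelsOfSectorGaps` (at fixed `(N, L)`, two real sector gaps against `E₀(N) ± μ` give the two momentum-zero channel
inequalities). Filters and real arithmetic only.

Proof. Fix `K > 0`, `κ := K/(2π)`. (1) `C⁺ ⇒ IRBoundFor v` is landed (`irBoundFor_of_linearFloor_of_integrable`): data
`ρ₀ˣ, C_X`, and for `ρ < ρ₀ˣ` eventually in `N` a slack `δ_X` with `n_k(Ψ) ≤ B := C_X√ρL/‖n‖_∞` for `δ_X`-near-minimisers on
the crux window `InWindow κ ρ N n`, which is the low window `2π‖n‖_∞/L ≤ K√ρ`. (2) The floor `LinearFloorFor v` at window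
constant `3K²`: the dual momentum `p = 2πn/L` has `‖p‖ = (2π/L)|n|₂ ≤ (2π/L)√3‖n‖_∞ ≤ √3K√ρ`
(`TransferArith.norm_latticeVec_eq`, `sqrt_nsq_le_sqrt_three_mul_norm`) and `‖p‖ ≥ 2π‖n‖_∞/L`
(`norm_intVec_le_sqrt_nsq`); data `θ, ρ₀ᶠ`, and eventually in `N`, `2E₀ + 2θ√ρ‖p‖ ≤ E₊ + E₋`, read in `ℝ` (all terms
finite by S9c and `periodicGroundStateEnergy_ne_top_of_lintegral_ne_top`): `2e₀ + 4πθ√ρ‖n‖_∞/L ≤ e₊ + e₋`.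
(3) Constants `ρ₀ := min ρ₀ˣ ρ₀ᶠ`, `C' := (2C_X + κ)/(4πθ) + 1`, `A := κ(C_X + κ)/C'`, `b := C'L²/‖n‖²_∞`; on the window
`1 ≤ ‖n‖_∞ ≤ κ√ρL` one checks `(2B+1)/b ≤ 4πθ√ρ‖n‖_∞/L` (`FloorArrow.twoB_add_one_div_le`) and `(B+1)/b ≤ Aρ`
(`FloorArrow.B_add_one_div_le`). (4) `μ := e₊ − e₀ − (B+1)/b` satisfies the particle gap with equality, the hole gap by
the floor, and `μ ≥ −(B+1)/b ≥ −Aρ` because `e₊ ≥ E₀(N+1) ≥ E₀(N)` (`periodicGroundStateEnergy_le_momentumSectorEnergy`,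
`WF.periodicGroundStateEnergy_le_succ`); S9a then gives both channels; take `μ₊ = μ₋ = μ`. Nothing is cited as a fact;
references for the shape only: T. Kennedy, E. H. Lieb, B. S. Shastry, J. Stat. Phys. 53 (1988) 1019, (12)–(14).
-/

noncomputable section

open scoped BigOperators ENNReal
open Filter MeasureTheory

namespace Summit.AtomisticToContinuum.BoseEinsteinCondensation.Cruxes.PeriodicIRBound.TwoSectorGdTransfer

open Literature.MathematicalPhysics.QuantumManyBody.BoseGas
open Summit.AtomisticToContinuum.BoseEinsteinCondensation.Theorems.PeriodicIRBound.Negative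
  (IRBoundFor NearMin InWindow IRIneq irIneq_iff norm_intVec_le_sqrt_nsq sqrt_nsq_le_sqrt_three_mul_norm)
open Summit.AtomisticToContinuum.BoseEinsteinCondensation.Theorems.GaussianDominationCan.Negative
  (nsq nsq_nonneg one_le_norm_intVec)
open Summit.AtomisticToContinuum.BoseEinsteinCondensation.Cruxes.PeriodicIRBound.LinearPhFloorWagner
  (LinearFloorFor irBoundFor_of_linearFloor_of_integrable TransferArith.norm_latticeVec_eq
    WF.periodicGroundStateEnergy_le_succ)
open Summit.AtomisticToContinuum.BoseEinsteinCondensation.Theorems.ZeroMomentumGround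
  (periodicGroundStateEnergy_ne_top_of_lintegral_ne_top)

/-! ### Real arithmetic of the two sector gaps on the window `1 ≤ ‖n‖_∞ ≤ κ√ρL` -/

namespace FloorArrow

/-- **Hole-gap arithmetic**: with `B = C_X s L/ν`, `b = C'L²/ν²`, `C' = (2C_X + κ)/(4πθ) + 1`, on the window
`1 ≤ ν ≤ κ s L` one has `(2B+1)/b ≤ 4πθ s ν/L` (`s = √ρ`, `ν = ‖n‖_∞`). [folklore] -/
theorem twoB_add_one_div_le {CX κ θ L s ν : ℝ} (hCX : 0 ≤ CX) (hκ : 0 ≤ κ) (hθ : 0 < θ) (hL : 0 < L)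
    (hs : 0 ≤ s) (hν1 : 1 ≤ ν) (hνL : ν ≤ κ * s * L) :
    (2 * (CX * s * L / ν) + 1) / (((2 * CX + κ) / (4 * Real.pi * θ) + 1) * L ^ 2 / ν ^ 2) ≤
      4 * Real.pi * θ * s * ν / L := by
  have hν : 0 < ν := one_pos.trans_le hν1
  have hC' : 0 < (2 * CX + κ) / (4 * Real.pi * θ) + 1 := by positivity
  set C' : ℝ := (2 * CX + κ) / (4 * Real.pi * θ) + 1 with hC'def
  have h1 : (2 * (CX * s * L / ν) + 1) / (C' * L ^ 2 / ν ^ 2) =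
      (2 * CX * s * L * ν + ν ^ 2) / (C' * L ^ 2) := by
    rw [div_eq_div_iff (by positivity) (by positivity)]
    field_simp
  have h2 : 2 * CX * s * L * ν + ν ^ 2 ≤ (2 * CX + κ) * s * L * ν := by
    nlinarith [mul_le_mul_of_nonneg_right hνL hν.le]
  have h3 : (2 * CX + κ) / C' ≤ 4 * Real.pi * θ := by
    rw [div_le_iff₀ hC', hC'def]
    have h4 : 4 * Real.pi * θ * ((2 * CX + κ) / (4 * Real.pi * θ) + 1) =
        2 * CX + κ + 4 * Real.pi * θ := by
      field_simp
    rw [h4]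
    linarith [show 0 < 4 * Real.pi * θ by positivity]
  calc (2 * (CX * s * L / ν) + 1) / (C' * L ^ 2 / ν ^ 2)
      = (2 * CX * s * L * ν + ν ^ 2) / (C' * L ^ 2) := h1
    _ ≤ (2 * CX + κ) * s * L * ν / (C' * L ^ 2) := div_le_div_of_nonneg_right h2 (by positivity)
    _ = (2 * CX + κ) / C' * (s * ν / L) := by
        field_simp
    _ ≤ 4 * Real.pi * θ * (s * ν / L) := mul_le_mul_of_nonneg_right h3 (by positivity)
    _ = 4 * Real.pi * θ * s * ν / L := by ring

/-- **Guard arithmetic**: with `B = C_X s L/ν`, `b = C'L²/ν²`, on the window `1 ≤ ν ≤ κ s L` one has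
`(B+1)/b ≤ κ(C_X + κ)/C' · s²`. [folklore] -/
theorem B_add_one_div_le {CX κ C' L s ν : ℝ} (hCX : 0 ≤ CX) (hC' : 0 < C') (hL : 0 < L) (hs : 0 ≤ s)
    (hν1 : 1 ≤ ν) (hνL : ν ≤ κ * s * L) :
    (CX * s * L / ν + 1) / (C' * L ^ 2 / ν ^ 2) ≤ κ * (CX + κ) / C' * s ^ 2 := by
  have hν : 0 < ν := one_pos.trans_le hν1
  have h1 : (CX * s * L / ν + 1) / (C' * L ^ 2 / ν ^ 2) = (CX * s * L * ν + ν ^ 2) / (C' * L ^ 2) := by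
    rw [div_eq_div_iff (by positivity) (by positivity)]
    field_simp
  have h2 : CX * s * L * ν + ν ^ 2 ≤ κ * (CX + κ) * s ^ 2 * L ^ 2 := by
    have hν2 : ν ^ 2 ≤ (κ * s * L) ^ 2 := pow_le_pow_left₀ hν.le hνL 2
    have hCXν : CX * s * L * ν ≤ CX * s * L * (κ * s * L) := mul_le_mul_of_nonneg_left hνL (by positivity)
    nlinarith [hν2, hCXν]
  calc (CX * s * L / ν + 1) / (C' * L ^ 2 / ν ^ 2)
      = (CX * s * L * ν + ν ^ 2) / (C' * L ^ 2) := h1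
    _ ≤ κ * (CX + κ) * s ^ 2 * L ^ 2 / (C' * L ^ 2) := div_le_div_of_nonneg_right h2 (by positivity)
    _ = κ * (CX + κ) / C' * s ^ 2 := by
        field_simp

end FloorArrow

/-! ### The stub -/

/-- **Stub S9b — the `C⁺`-arrow assembled from S9c and S9a.** Given finiteness of the lattice-momentum sector energies
(S9c) and the channels-from-sector-gaps principle at fixed `(N, L)` (S9a), line 1's linear particle–hole floor
`LinearFloorFor v` gives, for an integrable admissible `v` with `∫v ≠ 0` and every `K > 0`, data `ρ₀, C' > 0`, `A ≥ 0`
with `FloatingForLow v K ρ₀ C' A` (common chemical potential `μ₊ = μ₋ = E₊ − E₀ − (B+1)/b` at the top of the admissible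
interval; see the module docstring). [folklore] -/
theorem stub_linearFloorGivesFloatingLowOf : LinearFloorGivesFloatingLowOf := by
  intro h9c h9a v hv hint _h0 hfl K hK
  -- constants, part 1: `κ = K/(2π)`
  have hκ : 0 < K / (2 * Real.pi) := by positivity
  set κ : ℝ := K / (2 * Real.pi) with hκdef
  -- (1) the infrared bound from `C⁺` (landed), at window parameter `κ`
  have hIR : IRBoundFor v := irBoundFor_of_linearFloor_of_integrable v hv hint (fun _ => hfl)
  obtain ⟨ρX, hρX, CX, hCX, hIRW⟩ := hIR κ hκ
  -- (2) the floor at window constant `3K²`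
  obtain ⟨θ, hθ, ρF, hρF, hFl⟩ := hfl (3 * K ^ 2) (by positivity)
  -- (3) constants, part 2
  have hC' : 0 < (2 * CX + κ) / (4 * Real.pi * θ) + 1 := by positivity
  set C' : ℝ := (2 * CX + κ) / (4 * Real.pi * θ) + 1
  have hA : 0 ≤ κ * (CX + κ) / C' := by positivity
  set A : ℝ := κ * (CX + κ) / C'
  refine ⟨min ρX ρF, lt_min hρX hρF, C', hC', A, hA, fun ε hε ρ hρ hρlt => ?_⟩
  have hρ1 : ρ < ρX := hρlt.trans_le (min_le_left _ _)
  have hρ2 : ρ < ρF := hρlt.trans_le (min_le_right _ _)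
  -- (4) both eventualities, read along `N = m + 2`
  have hev := (tendsto_add_atTop_nat 2).eventually ((hIRW ρ hρ hρ1).and (hFl ρ hρ hρ2))
  filter_upwards [hev] with m hm
  obtain ⟨⟨δX, hδX, hIRm⟩, hFlm⟩ := hm
  intro n hn hwin
  -- (5) the mode: `L`, `ν = ‖n‖_∞`, the window, the dual momentum `p = 2πn/L`
  have hL : 0 < sideLength ρ (m + 2) := sideLength_pos_of_pos hρ (by omega)
  set L := sideLength ρ (m + 2)
  have hn1 : 1 ≤ ‖(fun j => (n j : ℝ))‖ := one_le_norm_intVec hn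
  set ν : ℝ := ‖(fun j => (n j : ℝ))‖
  have hν : 0 < ν := one_pos.trans_le hn1
  have hc : 0 < 2 * Real.pi / L := by positivity
  have hwin' : 2 * Real.pi * ν ≤ K * Real.sqrt ρ * L :=
    calc 2 * Real.pi * ν = 2 * Real.pi / L * ν * L := by field_simp
      _ ≤ K * Real.sqrt ρ * L := mul_le_mul_of_nonneg_right hwin hL.le
  have hνL : ν ≤ κ * Real.sqrt ρ * L := by
    rw [hκdef, div_mul_eq_mul_div, div_mul_eq_mul_div, le_div_iff₀ (by positivity : (0 : ℝ) < 2 * Real.pi)]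
    linarith
  have hnw : InWindow κ ρ (m + 2) n := ⟨hn, hνL⟩
  set p : Space := latticeVec (2 * Real.pi / L) n with hpdef
  have hP : ‖p‖ = 2 * Real.pi / L * Real.sqrt (nsq n) := by
    rw [hpdef, TransferArith.norm_latticeVec_eq, abs_of_pos hc]
  have hPge : 2 * Real.pi / L * ν ≤ ‖p‖ := by
    rw [hP]
    exact mul_le_mul_of_nonneg_left (norm_intVec_le_sqrt_nsq n) hc.le
  have hPpos : 0 < ‖p‖ := lt_of_lt_of_le (by positivity) hPge
  have hp0 : p ≠ 0 := norm_pos_iff.1 hPpos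
  have hP2 : ‖p‖ ^ 2 ≤ 3 * K ^ 2 * ρ := by
    have hPle : ‖p‖ ≤ Real.sqrt 3 * (K * Real.sqrt ρ) :=
      calc ‖p‖ ≤ 2 * Real.pi / L * (Real.sqrt 3 * ν) := by
            rw [hP]
            exact mul_le_mul_of_nonneg_left (sqrt_nsq_le_sqrt_three_mul_norm n) hc.le
        _ = Real.sqrt 3 * (2 * Real.pi / L * ν) := by ring
        _ ≤ Real.sqrt 3 * (K * Real.sqrt ρ) := mul_le_mul_of_nonneg_left hwin (Real.sqrt_nonneg _)
    calc ‖p‖ ^ 2 ≤ (Real.sqrt 3 * (K * Real.sqrt ρ)) ^ 2 := pow_le_pow_left₀ (norm_nonneg _) hPle 2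
      _ = 3 * K ^ 2 * ρ := by
          rw [mul_pow, mul_pow, Real.sq_sqrt (by norm_num : (0 : ℝ) ≤ 3), Real.sq_sqrt hρ.le]
          ring
  -- (6) finiteness of `E₀(N)`, `E₊ = E_{N+1}(p)`, `E₋ = E_{N-1}(p)`
  have hE0 : periodicGroundStateEnergy v (m + 2) L ≠ ⊤ :=
    periodicGroundStateEnergy_ne_top_of_lintegral_ne_top hv.1 hint (m + 2) hL
  have hEp : momentumSectorEnergy v (m + 2 + 1) L p ≠ ⊤ := h9c v hv.1 hint (m + 2 + 1) L (by omega) hL n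
  have hEm : momentumSectorEnergy v (m + 1) L p ≠ ⊤ := h9c v hv.1 hint (m + 1) L (by omega) hL n
  -- (7) the floor at `p`, read in `ℝ`
  have hfloor := hFlm p hp0 hP2
  rw [show m + 2 - 1 = m + 1 by omega] at hfloor
  set e0 : ℝ := (periodicGroundStateEnergy v (m + 2) L).toReal
  set eP : ℝ := (momentumSectorEnergy v (m + 2 + 1) L p).toReal
  set eM : ℝ := (momentumSectorEnergy v (m + 1) L p).toReal
  have hfloorR : 2 * e0 + 2 * θ * Real.sqrt ρ * ‖p‖ ≤ eP + eM := by
    have h := ENNReal.toReal_mono (ENNReal.add_ne_top.2 ⟨hEp, hEm⟩) hfloor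
    rwa [ENNReal.toReal_add (ENNReal.mul_ne_top ENNReal.ofNat_ne_top hE0) ENNReal.ofReal_ne_top,
      ENNReal.toReal_add hEp hEm, ENNReal.toReal_mul, ENNReal.toReal_ofReal (by positivity),
      ENNReal.toReal_ofNat] at h
  have hfloorN : 2 * e0 + 4 * Real.pi * θ * Real.sqrt ρ * ν / L ≤ eP + eM := by
    have h1 : 4 * Real.pi * θ * Real.sqrt ρ * ν / L = 2 * θ * Real.sqrt ρ * (2 * Real.pi / L * ν) := by
      ring
    have h2 : 2 * θ * Real.sqrt ρ * (2 * Real.pi / L * ν) ≤ 2 * θ * Real.sqrt ρ * ‖p‖ :=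
      mul_le_mul_of_nonneg_left hPge (by positivity)
    linarith
  have h0P : e0 ≤ eP :=
    ENNReal.toReal_mono hEp ((WF.periodicGroundStateEnergy_le_succ hL hv.1 (m + 2)).trans
      (periodicGroundStateEnergy_le_momentumSectorEnergy v (m + 2 + 1) L p))
  -- (8) the a-priori bound `B`, the channel bound `b`, and the two key inequalities
  have hB : 0 ≤ CX * Real.sqrt ρ * L / ν := by positivity
  have hb : 0 < C' * L ^ 2 / ν ^ 2 := by positivity
  have hKa : (2 * (CX * Real.sqrt ρ * L / ν) + 1) / (C' * L ^ 2 / ν ^ 2) ≤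
      4 * Real.pi * θ * Real.sqrt ρ * ν / L :=
    FloorArrow.twoB_add_one_div_le hCX.le hκ.le hθ hL (Real.sqrt_nonneg ρ) hn1 hνL
  have hKb : (CX * Real.sqrt ρ * L / ν + 1) / (C' * L ^ 2 / ν ^ 2) ≤ A * ρ := by
    have h := FloorArrow.B_add_one_div_le hCX.le hC' hL (Real.sqrt_nonneg ρ) hn1 hνL
    rwa [Real.sq_sqrt hρ.le] at h
  set B : ℝ := CX * Real.sqrt ρ * L / ν
  set b : ℝ := C' * L ^ 2 / ν ^ 2
  -- (9) the occupation bound on momentum-zero `δ_X`-near-minimisers, from the infrared bound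
  have hocc : ∀ Ψ : PeriodicTrialState (m + 2) L, NearMinAt v δX Ψ → HasTotalMomentum 0 Ψ.ψ →
      (cellOccupation (m + 2) L (planeWaveMode L n) Ψ.ψ).toReal ≤ B := by
    intro Ψ hΨ _
    have h := hIRm Ψ ((nearMin_iff v ρ (m + 2) δX Ψ).2 hΨ) n hnw
    rw [irIneq_iff] at h
    exact ENNReal.toReal_le_of_le_ofReal hB h
  -- (10) the common chemical potential `μ = e₊ - e₀ - (B+1)/b`: the two sector gaps and the guard
  have gapP : e0 + (eP - e0 - (B + 1) / b) + (B + 1) / b ≤ eP := by linarith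
  have gapM : e0 - (eP - e0 - (B + 1) / b) + B / b ≤ eM := by
    have h1 : e0 - (eP - e0 - (B + 1) / b) + B / b = 2 * e0 - eP + (2 * B + 1) / b := by ring
    rw [h1]
    linarith
  have hguard : -(A * ρ) ≤ eP - e0 - (B + 1) / b := by linarith
  -- (11) channels from sector gaps
  obtain ⟨hPch, hMch⟩ :=
    h9a v hv hint m L hL n hn b B (eP - e0 - (B + 1) / b) δX hb hB hδX hocc hE0 hEp hEm gapP gapM
  exact ⟨eP - e0 - (B + 1) / b, eP - e0 - (B + 1) / b, hguard, le_add_of_nonneg_right (by positivity),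
    hPch, hMch⟩

end Summit.AtomisticToContinuum.BoseEinsteinCondensation.Cruxes.PeriodicIRBound.TwoSectorGdTransfer

end
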